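import Mathlib

/-!
# Trigonal injectivity — the arithmetic core (ym-idea-3 g21; crux ⟨stmt-QuantumFields-23035⟩, stub `stub_oddModeRigidity`)

Kernel-checked anchor for step (6) of `Cruxes/ShortRootRigidity/TrigonalInjectivity.md` §1:
with `π = 2 + √-3`, `(a n, b n)` the integer coordinates of `π ^ n = a n + b n · √-3`
(`a 0 = 1, b 0 = 0`, `a (n+1) = 2 a n - 3 b n`, `b (n+1) = a n + 2 b n`), one has
`a (6 s) ≡ 4 (mod 7)` for every `s ≥ 1`, hence `A_s := Re (2+√-3)^(6 s) = a (6 s) ≠ 1`.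
In the note this is what forces the sectoral amplitude `a` of a would-be counterexample to (P_s) to vanish
(identity (★): `a · (A_s - 1) = 0`).  Honest label: this file proves ONLY the arithmetic; (P_s), NoBadModes,
OddModeRigidity, ⟨23035⟩, ⟨23125⟩ and every summit remain open in the tree.  No summit is proved by a line.
-/

namespace Summit.QuantumFields.YangMills.Cruxes.ShortRootRigidity.TrigonalArithmetic

/-- Integer coordinates of `(2 + √-3)^n = (ab n).1 + (ab n).2 · √-3`. -/
def ab : ℕ → ℤ × ℤ
  | 0 => (1, 0)
  | n + 1 => (2 * (ab n).1 - 3 * (ab n).2, (ab n).1 + 2 * (ab n).2)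

/-- The same recurrence read in `ZMod 7`. -/
def abMod : ℕ → ZMod 7 × ZMod 7
  | 0 => (1, 0)
  | n + 1 => (2 * (abMod n).1 - 3 * (abMod n).2, (abMod n).1 + 2 * (abMod n).2)

theorem abMod_eq_cast (n : ℕ) :
    abMod n = ((((ab n).1 : ℤ) : ZMod 7), (((ab n).2 : ℤ) : ZMod 7)) := by
  induction n with
  | zero => rfl
  | succ k ih =>
      show (2 * (abMod k).1 - 3 * (abMod k).2, (abMod k).1 + 2 * (abMod k).2)
        = ((((2 * (ab k).1 - 3 * (ab k).2 : ℤ)) : ZMod 7), (((ab k).1 + 2 * (ab k).2 : ℤ) : ZMod 7))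
      rw [ih]
      ext <;> push_cast <;> ring

theorem ab_six : ab 6 = (-143, -180) := by decide

theorem abMod_four : abMod 4 = abMod 1 := by decide

/-- From index 1 on, the residues mod 7 are periodic with period 3. -/
theorem abMod_periodic (k : ℕ) : abMod (k + 4) = abMod (k + 1) := by
  induction k with
  | zero => exact abMod_four
  | succ k ih =>
      show (2 * (abMod (k + 4)).1 - 3 * (abMod (k + 4)).2, (abMod (k + 4)).1 + 2 * (abMod (k + 4)).2)
        = (2 * (abMod (k + 1)).1 - 3 * (abMod (k + 1)).2, (abMod (k + 1)).1 + 2 * (abMod (k + 1)).2)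
      rw [ih]

theorem abMod_add_three_mul (k m : ℕ) : abMod (k + 1 + 3 * m) = abMod (k + 1) := by
  induction m with
  | zero => simp
  | succ m ih =>
      have h : k + 1 + 3 * (m + 1) = (k + 3 * m) + 4 := by ring
      rw [h, abMod_periodic, show k + 3 * m + 1 = k + 1 + 3 * m by ring, ih]

theorem abMod_three : abMod 3 = (4, 2) := by decide

/-- `Re (2+√-3)^(6s) ≡ 4` and `Im-coordinate ≡ 2 (mod 7)` for `s ≥ 1`. -/
theorem abMod_six_mul (s : ℕ) (hs : 1 ≤ s) : abMod (6 * s) = (4, 2) := by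
  obtain ⟨t, rfl⟩ := Nat.exists_eq_add_of_le hs
  have h : 6 * (1 + t) = 2 + 1 + 3 * (2 * t + 1) := by ring
  rw [h, abMod_add_three_mul]
  exact abMod_three

/-- THE ARITHMETIC CORE: `A_s = Re (2 + √-3)^(6 s) ≠ 1` for every `s ≥ 1`
(indeed `A_s ≡ 4 (mod 7)`); e.g. `A_1 = -143`. -/
theorem re_pow_six_mul_ne_one (s : ℕ) (hs : 1 ≤ s) : (ab (6 * s)).1 ≠ 1 := by
  intro h1
  have hmod := abMod_six_mul s hs
  rw [abMod_eq_cast, h1] at hmod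
  have h4 : ((1 : ℤ) : ZMod 7) = 4 := (Prod.mk.inj hmod).1
  revert h4
  decide

/-- The sectoral amplitude vanishes: identity (★) of the note with `A_s ≠ 1`. -/
theorem amplitude_eq_zero (s : ℕ) (hs : 1 ≤ s) (a : ℝ)
    (hstar : a * (((ab (6 * s)).1 : ℝ) - 1) = 0) : a = 0 := by
  rcases mul_eq_zero.mp hstar with h | h
  · exact h
  · exfalso
    have : ((ab (6 * s)).1 : ℝ) = 1 := by linarith
    exact re_pow_six_mul_ne_one s hs (by exact_mod_cast this)

end Summit.QuantumFields.YangMills.Cruxes.ShortRootRigidity.TrigonalArithmetic
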